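import Literature.MathematicalPhysics.QuantumFieldTheory.Balaban1983to89.B2Eq337ScalarIntegration

/-!
# `Balaban1983to89.B2Eq325ConcreteSchur` — [Balaban1982Higgs2] §3.B p. 589, file 2/3 of the scalar-field integration
chain: **(3.25) «(3.23) = Z(Ã^ε)exp(−½⟨Φ, Δ(Ã^ε)Φ⟩)» ON THE CONCRETE (Higgs)₂,₃ CARRIER** — the integral (3.23) over
`φ₀↾_{Λ₅⁽⁰⁾}` (with the constants of the renormalization transformations) IS a centred Gaussian in the configuration `Φ` of
(3.24): `F325(Φ) = Z325 · exp(−½⟨Φ, Δ(Ã^ε)Φ⟩)` with `Z325 = F325(0) > 0` and `Δ(Ã^ε)` the Schur complement of the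
`φ₀↾_{Λ₅⁽⁰⁾}`-block of the joint quadratic exponent — PROVED by completing the square on the fibre

statement-level skeleton of published theorems with citation tags; proofs where landed; nothing here is a claim about the Yang–Mills mass gap

CITATION HEADER.  T. Bałaban, *(Higgs)₂,₃ quantum fields in a finite volume. II. An upper bound*, Commun. Math. Phys. **86**
(1982) 555–594 [Balaban1982Higgs2] (cell paper B2; PDF held `paper:balaban1982-cmp86-higgs23-ii`, journal page = PDF page
+ 554; pp. 588–591 READ AS IMAGES on the ×2 renders
`run/shared/lean/pub/pub-balaban/b2b-balaban-ref1/pages/1982-cmp86-higgs23-II/1982-cmp86-higgs23-II-p034-x2.png` … `-p037-x2.png`).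
Unit `lit-balaban-p15` gen 4 (Phase-2 proof seat p15; HOME `run/shared/lean/pub/lit-balaban/`).  SKELETON row **B2.Eq3.32**
((3.30)–(3.41); fold owner r02, second readers r14/r13, referee ref-4) and row **B2.Eq3.25** ((3.21)–(3.25); (3.25)
was proved in schematic matrix coordinates by `…B2Sect3BSchurStep.eq325`, p246077 — here on the concrete carrier of file 1/3
`…B2Eq337ScalarIntegration`, whose objects `Regions`/`Cfg`/`InCfg`/`field`/`exponent323`/`F325` are used by name).

WHAT IS PRINTED (verbatim, p. 589 [PDF 35]): *"and we will write the integral (3.23) in the form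
(3.23) = Z(Ã^ε)exp(−½⟨Φ, Δ(Ã^ε)Φ⟩). (3.25) The properties of the quadratic form in the above exponent are fundamental for
further analysis."*; p. 590: *"… where all the constants coming from the renormalization transformations are included in
Z(Ã^ε)."*

WHAT THIS MODULE PROVES (kernel-checked, 0 `sorry`, standard axioms).
§4a GENERIC (namespace `Fibre`): for a bilinear form `Q` on `W × U` (`U` finite-dimensional), symmetric with positive
   definite fibre block `u ↦ Q((0,u),(0,u))`: the fibre minimiser `fibreMin` (linear in `w`; `fibreB_fibreMin`), the Schur
   complement `fibreForm w = Q((w,u₀(w)),(w,u₀(w)))` = the bilinear `schur` on the diagonal (`fibreForm_eq_schur`),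
   completing the square (`decomposition`), `fibreForm_smul`/`_zero`/`_le`/`_nonneg`, `iInf_eq_fibreForm` (it is the fibre
   minimum), and the Gaussian fibre integral `integral_eq`: `∫du e^{−½Q((w,u),(w,u))} = e^{−½s(w)}·∫du e^{−½Q((0,u),(0,u))}` for
   any translation-invariant `du` (no integrability needed).
§4b THE JOINT FORM OF (3.23): `jointForm` (a bilinear form on `Cfg × InCfg` built from the tree's `avgQkLin`, `delta0`,
   `siteInner`), `exponent323_eq_jointForm` (**the exponent (3.23) is `−½·jointForm(z,z)`**), `jointForm_symm`
   (`siteInner_delta0_comm` ← `siteInner_covLaplacianN_comm`), `jointForm_self_nonneg`, and **`jointForm_fibre_pos`**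
   (`m² > 0`: the `φ₀↾_{Λ₅⁽⁰⁾}`-block is positive definite, `≥ m²ε^d|u(x)|²`).
§4c **(3.25)**: `form325 Φ := ⨅_u jointForm((Φ,u),(Φ,u))` = ⟨Φ, Δ(Ã^ε)Φ⟩ (`form325_eq_fibreForm`, `form325_eq_delta325`
   with the bilinear operator `delta325` = Δ(Ã^ε), `form325_le`, `form325_nonneg`, `form325_smul`, `form325_zero`),
   `Z325 := F325(0)`, **`eq325_concrete`**: `F325(Φ) = Z325·exp(−½·form325 Φ)`, and **`Z325_pos`** (from (3.36) = (3.37) of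
   file 1/3: a non-positive `Z` would make `∫dΦ F325 ≤ 0 < ∫dφ₀ e^{−½⟨φ₀,(−Δ_Ã+m²)φ₀⟩}`).
HONEST SCOPE.  Proposition 3.1 (3.26) about ⟨Φ, Δ(Ã^ε)Φ⟩ is untouched (b2b's `B2.Prop31Printed`); `Δ(Ã^ε)` is produced as
the Schur-complement bilinear form `delta325`, not as an explicit lattice operator.
-/

noncomputable section

open MeasureTheory Finset Real
open scoped BigOperators ENNReal InnerProductSpace

namespace Literature.MathematicalPhysics.QuantumFieldTheory.Balaban1983to89.B2Eq325ConcreteSchur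

open Literature.MathematicalPhysics.QuantumFieldTheory.Balaban1983to89.HiggsLattice
open Literature.MathematicalPhysics.QuantumFieldTheory.Balaban1983to89.HiggsAveraging
open Literature.MathematicalPhysics.QuantumFieldTheory.Balaban1983to89.HiggsCovariance
open Literature.MathematicalPhysics.QuantumFieldTheory.Balaban1983to89.HiggsCovariancePos
open Literature.MathematicalPhysics.QuantumFieldTheory.Balaban1983to89.B2Ineq338Diamagnetic
open Literature.MathematicalPhysics.QuantumFieldTheory.Balaban1983to89.B2Eq337ScalarIntegration

variable {P : HiggsLattice.Params} {N K : ℕ}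

/-! ## §4a Completing the square on a fibre (generic finite-dimensional bookkeeping behind (3.25)) -/

namespace Fibre

variable {W U : Type*} [AddCommGroup W] [Module ℝ W] [AddCommGroup U] [Module ℝ U]

/-- The fibre block `B(u, u′) = Q((0,u), (0,u′))` of a bilinear form on `W × U`. [folklore] [cite: Balaban1982Higgs2, (3.25) p.589] -/
def fibreB (Q : LinearMap.BilinForm ℝ (W × U)) : LinearMap.BilinForm ℝ U :=
  Q.compl₁₂ (LinearMap.inr ℝ W U) (LinearMap.inr ℝ W U)

/-- The cross block `ℓ_w(u) = Q((w,0), (0,u))`. [folklore] [cite: Balaban1982Higgs2, (3.25) p.589] -/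
def cross (Q : LinearMap.BilinForm ℝ (W × U)) : W →ₗ[ℝ] Module.Dual ℝ U :=
  Q.compl₁₂ (LinearMap.inl ℝ W U) (LinearMap.inr ℝ W U)

/-- Unfolding `fibreB`. [folklore] [cite: Balaban1982Higgs2, (3.25) p.589] -/
@[simp] theorem fibreB_apply (Q : LinearMap.BilinForm ℝ (W × U)) (u u' : U) :
    fibreB Q u u' = Q ((0 : W), u) ((0 : W), u') := by
  simp [fibreB]

/-- Unfolding `cross`. [folklore] [cite: Balaban1982Higgs2, (3.25) p.589] -/
@[simp] theorem cross_apply (Q : LinearMap.BilinForm ℝ (W × U)) (w : W) (u : U) :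
    cross Q w u = Q (w, (0 : U)) ((0 : W), u) := by
  simp [cross]

variable [FiniteDimensional ℝ U] (Q : LinearMap.BilinForm ℝ (W × U))

omit [FiniteDimensional ℝ U] in
/-- A fibre block that is positive definite is injective as a map `U → U*`. [folklore] [cite: Balaban1982Higgs2, (3.25) p.589] -/
theorem fibreB_injective (hpos : ∀ u : U, u ≠ 0 → 0 < Q ((0 : W), u) ((0 : W), u)) :
    Function.Injective (fibreB Q) := by
  intro u v huv
  by_contra hne
  have h0 : fibreB Q (u - v) = 0 := by
    rw [map_sub, huv, sub_self]
  have h1 : fibreB Q (u - v) (u - v) = 0 := by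
    rw [h0, LinearMap.zero_apply]
  have h2 := hpos (u - v) (sub_ne_zero.2 hne)
  rw [fibreB_apply] at h1
  linarith

/-- `U ≃ U*` through a positive definite fibre block (finite dimension: injective ⇒ bijective). [folklore]
[cite: Balaban1982Higgs2, (3.25) p.589] -/
def fibreEquiv (hpos : ∀ u : U, u ≠ 0 → 0 < Q ((0 : W), u) ((0 : W), u)) : U ≃ₗ[ℝ] Module.Dual ℝ U :=
  LinearMap.linearEquivOfInjective (fibreB Q) (fibreB_injective Q hpos) Subspace.dual_finrank_eq.symm

/-- The equivalence is the fibre block. [folklore] [cite: Balaban1982Higgs2, (3.25) p.589] -/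
theorem fibreEquiv_apply (hpos : ∀ u : U, u ≠ 0 → 0 < Q ((0 : W), u) ((0 : W), u)) (u : U) :
    fibreEquiv Q hpos u = fibreB Q u :=
  LinearMap.linearEquivOfInjective_apply _ _ u

/-- **The fibre minimiser** `u₀(w)`: the solution of `B u₀ = −ℓ_w` (the point where `u ↦ Q((w,u),(w,u))` is minimal),
linear in `w`. [folklore] [cite: Balaban1982Higgs2, (3.25) p.589] -/
def fibreMin (hpos : ∀ u : U, u ≠ 0 → 0 < Q ((0 : W), u) ((0 : W), u)) : W →ₗ[ℝ] U :=
  -((fibreEquiv Q hpos).symm.toLinearMap ∘ₗ cross Q)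

/-- The defining equation of the minimiser: `Q((0,u₀(w)), (0,u)) = −Q((w,0), (0,u))`. [folklore]
[cite: Balaban1982Higgs2, (3.25) p.589] -/
theorem fibreB_fibreMin (hpos : ∀ u : U, u ≠ 0 → 0 < Q ((0 : W), u) ((0 : W), u)) (w : W) (u : U) :
    Q ((0 : W), fibreMin Q hpos w) ((0 : W), u) = -Q (w, (0 : U)) ((0 : W), u) := by
  have h : fibreB Q (fibreMin Q hpos w) = -(cross Q w) := by
    have h1 : fibreMin Q hpos w = -((fibreEquiv Q hpos).symm (cross Q w)) := rfl
    rw [h1, map_neg, ← fibreEquiv_apply Q hpos, LinearEquiv.apply_symm_apply]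
  have h2 := LinearMap.congr_fun h u
  rw [fibreB_apply, LinearMap.neg_apply, cross_apply] at h2
  exact h2

/-- **The Schur complement as the value at the minimiser**: `s(w) = Q((w,u₀(w)), (w,u₀(w)))`. [folklore]
[cite: Balaban1982Higgs2, (3.25) p.589] -/
def fibreForm (hpos : ∀ u : U, u ≠ 0 → 0 < Q ((0 : W), u) ((0 : W), u)) (w : W) : ℝ :=
  Q (w, fibreMin Q hpos w) (w, fibreMin Q hpos w)

/-- The Schur complement as a BILINEAR form on `W`: `S(w, w′) = Q((w,u₀(w)), (w′,u₀(w′)))`. [folklore]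
[cite: Balaban1982Higgs2, (3.25) p.589] -/
def schur (hpos : ∀ u : U, u ≠ 0 → 0 < Q ((0 : W), u) ((0 : W), u)) : LinearMap.BilinForm ℝ W :=
  Q.compl₁₂ (LinearMap.id.prod (fibreMin Q hpos)) (LinearMap.id.prod (fibreMin Q hpos))

/-- `s(w) = S(w, w)`: the fibre value IS the quadratic form of the Schur-complement bilinear form. [folklore]
[cite: Balaban1982Higgs2, (3.25) p.589] -/
theorem fibreForm_eq_schur (hpos : ∀ u : U, u ≠ 0 → 0 < Q ((0 : W), u) ((0 : W), u)) (w : W) :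
    fibreForm Q hpos w = schur Q hpos w w := by
  simp [fibreForm, schur]

/-- **Completing the square**: `Q((w,u),(w,u)) = Q((0,u−u₀),(0,u−u₀)) + s(w)` for a symmetric `Q` with positive
definite fibre block. [folklore] [cite: Balaban1982Higgs2, (3.25) p.589] -/
theorem decomposition (hsymm : ∀ z z' : W × U, Q z z' = Q z' z)
    (hpos : ∀ u : U, u ≠ 0 → 0 < Q ((0 : W), u) ((0 : W), u)) (w : W) (u : U) :
    Q (w, u) (w, u) = Q ((0 : W), u - fibreMin Q hpos w) ((0 : W), u - fibreMin Q hpos w) + fibreForm Q hpos w := by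
  set m := fibreMin Q hpos w with hm
  have hz : ((w, u) : W × U) = (w, m) + ((0 : W), u - m) := by ext <;> simp
  have hcross : Q (w, m) ((0 : W), u - m) = 0 := by
    have h1 : ((w, m) : W × U) = (w, (0 : U)) + ((0 : W), m) := by ext <;> simp
    rw [h1, LinearMap.map_add₂, hm, fibreB_fibreMin Q hpos w (u - fibreMin Q hpos w)]
    ring
  rw [hz, LinearMap.map_add₂, map_add, map_add, hsymm ((0 : W), u - m) (w, m), hcross, add_zero, zero_add,
    add_comm]
  rfl

/-- Homogeneity: `s(tw) = t²s(w)`. [folklore] [cite: Balaban1982Higgs2, (3.36) p.591] -/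
theorem fibreForm_smul (hpos : ∀ u : U, u ≠ 0 → 0 < Q ((0 : W), u) ((0 : W), u)) (t : ℝ) (w : W) :
    fibreForm Q hpos (t • w) = t ^ 2 * fibreForm Q hpos w := by
  unfold fibreForm
  have h : ((t • w, fibreMin Q hpos (t • w)) : W × U) = t • (w, fibreMin Q hpos w) := by
    rw [map_smul, Prod.smul_mk]
  rw [h, LinearMap.map_smul₂, map_smul, smul_eq_mul, smul_eq_mul]
  ring

/-- `s(0) = 0`. [folklore] [cite: Balaban1982Higgs2, (3.25) p.589] -/
theorem fibreForm_zero (hpos : ∀ u : U, u ≠ 0 → 0 < Q ((0 : W), u) ((0 : W), u)) :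
    fibreForm Q hpos 0 = 0 := by
  have h := fibreForm_smul Q hpos 0 (0 : W)
  simpa using h

/-- `s(w) ≤ Q((w,u),(w,u))` for every `u` (the fibre block being non-negative): `s` is the fibre minimum. [folklore]
[cite: Balaban1982Higgs2, (3.25) p.589] -/
theorem fibreForm_le (hsymm : ∀ z z' : W × U, Q z z' = Q z' z)
    (hpos : ∀ u : U, u ≠ 0 → 0 < Q ((0 : W), u) ((0 : W), u)) (w : W) (u : U) :
    fibreForm Q hpos w ≤ Q (w, u) (w, u) := by
  rw [decomposition Q hsymm hpos w u]
  have h : 0 ≤ Q ((0 : W), u - fibreMin Q hpos w) ((0 : W), u - fibreMin Q hpos w) := by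
    by_cases h0 : u - fibreMin Q hpos w = 0
    · simp only [h0, Prod.mk_zero_zero, map_zero, le_refl]
    · exact (hpos _ h0).le
  linarith

/-- `s(w) ≥ 0` when `Q ≥ 0`. [folklore] [cite: Balaban1982Higgs2, (3.25) p.589] -/
theorem fibreForm_nonneg (hpos : ∀ u : U, u ≠ 0 → 0 < Q ((0 : W), u) ((0 : W), u))
    (hQ : ∀ z : W × U, 0 ≤ Q z z) (w : W) : 0 ≤ fibreForm Q hpos w :=
  hQ _

/-- The fibre minimum as an infimum: `⨅_u Q((w,u),(w,u)) = s(w)`. [folklore] [cite: Balaban1982Higgs2, (3.25) p.589] -/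
theorem iInf_eq_fibreForm (hsymm : ∀ z z' : W × U, Q z z' = Q z' z)
    (hpos : ∀ u : U, u ≠ 0 → 0 < Q ((0 : W), u) ((0 : W), u)) (w : W) :
    (⨅ u : U, Q (w, u) (w, u)) = fibreForm Q hpos w := by
  refine le_antisymm (ciInf_le ⟨fibreForm Q hpos w, ?_⟩ (fibreMin Q hpos w)) (le_ciInf fun u => fibreForm_le Q hsymm hpos w u)
  rintro _ ⟨u, rfl⟩
  exact fibreForm_le Q hsymm hpos w u

/-- **The Gaussian fibre integral** (the content of (3.25)): for a symmetric `Q` with positive definite fibre block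
and a translation-invariant measure `du`, `∫du e^{−½Q((w,u),(w,u))} = e^{−½s(w)} · ∫du e^{−½Q((0,u),(0,u))}` — complete the
square and translate `u ↦ u + u₀(w)`. No integrability needed. [folklore] [cite: Balaban1982Higgs2, (3.25) p.589] -/
theorem integral_eq {U' : Type*} [NormedAddCommGroup U'] [NormedSpace ℝ U'] [FiniteDimensional ℝ U'] [MeasurableSpace U']
    [BorelSpace U'] (μ : Measure U') [μ.IsAddRightInvariant] (Q' : LinearMap.BilinForm ℝ (W × U'))
    (hsymm : ∀ z z' : W × U', Q' z z' = Q' z' z) (hpos : ∀ u : U', u ≠ 0 → 0 < Q' ((0 : W), u) ((0 : W), u)) (w : W) :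
    ∫ u, Real.exp (-(1/2 : ℝ) * Q' (w, u) (w, u)) ∂μ
      = Real.exp (-(1/2 : ℝ) * fibreForm Q' hpos w) * ∫ u, Real.exp (-(1/2 : ℝ) * Q' ((0 : W), u) ((0 : W), u)) ∂μ := by
  have h : ∀ u : U', Real.exp (-(1/2 : ℝ) * Q' (w, u) (w, u))
      = Real.exp (-(1/2 : ℝ) * fibreForm Q' hpos w)
        * Real.exp (-(1/2 : ℝ) * Q' ((0 : W), u - fibreMin Q' hpos w) ((0 : W), u - fibreMin Q' hpos w)) := by
    intro u
    rw [decomposition Q' hsymm hpos w u, ← Real.exp_add]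
    ring_nf
  simp_rw [h]
  rw [integral_const_mul]
  congr 1
  exact integral_sub_right_eq_self (fun u : U' => Real.exp (-(1/2 : ℝ) * Q' ((0 : W), u) ((0 : W), u)))
    (fibreMin Q' hpos w)

end Fibre

/-! ## §4b (3.25) on the concrete carrier: the exponent of (3.23) is a quadratic form in `(Φ, φ₀↾_{Λ₅⁽⁰⁾})` -/

section Eq325

variable (R : Regions P K) (C : ChargeData N) (a : ℝ) (A : HiggsLattice.VecField P 0) (msq : ℝ)

/-- The re-gluing `(Φ, φ₀↾_{Λ₅⁽⁰⁾}) ↦ φ₀` as a linear map. [folklore] [cite: Balaban1982Higgs2, (3.24) p.588] -/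
def fieldLin (R : Regions P K) : (Cfg R N × InCfg R N) →ₗ[ℝ] ScalarField P 0 N where
  toFun z := field R z.1.1 z.2
  map_add' z z' := by
    funext x
    by_cases h : R.isIn x <;> simp [field, h]
  map_smul' t z := by
    funext x
    by_cases h : R.isIn x <;> simp [field, h]

/-- Unfolding `fieldLin`. [folklore] [cite: Balaban1982Higgs2, (3.24) p.588] -/
@[simp] theorem fieldLin_apply (z : Cfg R N × InCfg R N) : fieldLin (N := N) R z = field R z.1.1 z.2 := rfl

/-- `(Φ, φ₀↾_{Λ₅⁽⁰⁾}) ↦ φ_k(x_k) − (Q_k(Ã^ε)φ₀)(x_k)` as a linear map (block site `x_k`). [cite: Balaban1982Higgs2, (3.23) p.588] -/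
def diffLin (s : R.BlockSite) : (Cfg R N × InCfg R N) →ₗ[ℝ] V N :=
  (LinearMap.proj s ∘ₗ LinearMap.snd ℝ (R.OutSite → V N) (R.BlockSite → V N) ∘ₗ LinearMap.fst ℝ (Cfg R N) (InCfg R N))
    - ((LinearMap.proj s.2.val : ScalarField P (R.lvl s) N →ₗ[ℝ] V N) ∘ₗ avgQkLin C A (R.lvl s) ∘ₗ fieldLin R)

/-- Unfolding `diffLin`. [cite: Balaban1982Higgs2, (3.23) p.588] -/
@[simp] theorem diffLin_apply (s : R.BlockSite) (z : Cfg R N × InCfg R N) :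
    diffLin R C A s z = z.1.2 s - qMean C A R (field R z.1.1 z.2) s := rfl

/-- The scalar product (1.5) `⟨f, g⟩ = Σ_x η^d f(x)·g(x)` as a bilinear form. [cite: Balaban1982Higgs2, (3.23) p.588] -/
def siteBilin (P : HiggsLattice.Params) (k N : ℕ) : ScalarField P k N →ₗ[ℝ] ScalarField P k N →ₗ[ℝ] ℝ :=
  ∑ x : HiggsLattice.Site P k, (P.mesh k ^ P.d) •
    (innerₗ (V N)).compl₁₂ (LinearMap.proj x : ScalarField P k N →ₗ[ℝ] V N) (LinearMap.proj x : ScalarField P k N →ₗ[ℝ] V N)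

/-- `siteBilin f g = ⟨f, g⟩` (the tree's `HiggsLattice.siteInner`). [cite: Balaban1982Higgs2, (3.23) p.588] -/
@[simp] theorem siteBilin_apply {k : ℕ} (f g : ScalarField P k N) : siteBilin P k N f g = siteInner f g := by
  simp [siteBilin, siteInner, LinearMap.sum_apply, innerₗ_apply_apply]

/-- **The joint quadratic form of (3.23)**: the bilinear form on `(Φ, φ₀↾_{Λ₅⁽⁰⁾})` whose diagonal is
`Σ_k a_k(Lᵏε)^{d−2} Σ_{x_k∈Λ_k}|φ_k(x_k) − (Q_k(Ã^ε)φ₀)(x_k)|² + ⟨φ₀,(−Δ^ε_{Ã^ε}+m²)φ₀⟩` = `−2 ×` the exponent (3.23).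
[cite: Balaban1982Higgs2, (3.23) p.588] -/
def jointForm : LinearMap.BilinForm ℝ (Cfg R N × InCfg R N) :=
  (∑ s : R.BlockSite, precAt P a (R.lvl s) • (innerₗ (V N)).compl₁₂ (diffLin R C A s) (diffLin R C A s))
    + (siteBilin P 0 N).compl₁₂ (fieldLin R) (delta0 C Finset.univ A msq ∘ₗ fieldLin R)

/-- Unfolding the joint form. [cite: Balaban1982Higgs2, (3.23) p.588] -/
theorem jointForm_apply (z z' : Cfg R N × InCfg R N) :
    jointForm R C a A msq z z'
      = (∑ s : R.BlockSite, precAt P a (R.lvl s)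
          * ⟪z.1.2 s - qMean C A R (field R z.1.1 z.2) s, z'.1.2 s - qMean C A R (field R z'.1.1 z'.2) s⟫_ℝ)
        + siteInner (field R z.1.1 z.2) (delta0 C Finset.univ A msq (field R z'.1.1 z'.2)) := by
  simp only [jointForm, LinearMap.add_apply, LinearMap.sum_apply, LinearMap.smul_apply, LinearMap.compl₁₂_apply,
    innerₗ_apply_apply, diffLin_apply, siteBilin_apply, fieldLin_apply, LinearMap.comp_apply, smul_eq_mul]

/-- **The exponent of (3.23) is `−½ ×` the joint quadratic form.** [cite: Balaban1982Higgs2, (3.23) p.588] -/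
theorem exponent323_eq_jointForm (Φ : Cfg R N) (u : InCfg R N) :
    exponent323 R C a A msq Φ u = -(1/2 : ℝ) * jointForm R C a A msq (Φ, u) (Φ, u) := by
  rw [jointForm_apply, exponent323]
  simp only [real_inner_self_eq_norm_sq]
  ring

/-- `⟨f, (−Δ^ε_{Ã,Ω}+m²)g⟩ = ⟨g, (−Δ^ε_{Ã,Ω}+m²)f⟩` (the operator is symmetric for (1.5); tree:
`siteInner_covLaplacianN_comm`). [cite: Balaban1982Higgs2, (3.23) p.588] -/
theorem siteInner_delta0_comm (Ω : Finset (HiggsLattice.Site P 0)) (f g : ScalarField P 0 N) :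
    siteInner f (delta0 C Ω A msq g) = siteInner g (delta0 C Ω A msq f) := by
  have h1 : siteInner f (delta0 C Ω A msq g) = siteInner f (covLaplacianN C Ω A g) + msq * siteInner f g := by
    rw [← siteBilin_apply, delta0_apply, map_add, map_smul, siteBilin_apply, siteBilin_apply, smul_eq_mul]
  have h2 : siteInner g (delta0 C Ω A msq f) = siteInner g (covLaplacianN C Ω A f) + msq * siteInner g f := by
    rw [← siteBilin_apply, delta0_apply, map_add, map_smul, siteBilin_apply, siteBilin_apply, smul_eq_mul]
  have h3 : siteInner f g = siteInner g f := by
    unfold siteInner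
    exact Finset.sum_congr rfl fun x _ => by rw [real_inner_comm]
  rw [h1, h2, siteInner_covLaplacianN_comm, h3]

/-- The joint form is symmetric. [cite: Balaban1982Higgs2, (3.23) p.588] -/
theorem jointForm_symm (z z' : Cfg R N × InCfg R N) :
    jointForm R C a A msq z z' = jointForm R C a A msq z' z := by
  rw [jointForm_apply, jointForm_apply, siteInner_delta0_comm]
  congr 1
  exact Finset.sum_congr rfl fun s _ => by rw [real_inner_comm]

/-- `⟨f,(−Δ^ε_{Ã,Ω}+m²)f⟩ ≥ m²⟨f,f⟩` (the Laplacian part is non-negative: `siteInner_covLaplacianN_nonneg`).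
[cite: Balaban1982Higgs2, (3.23) p.588] -/
theorem siteInner_delta0_ge (Ω : Finset (HiggsLattice.Site P 0)) (f : ScalarField P 0 N) :
    msq * siteInner f f ≤ siteInner f (delta0 C Ω A msq f) := by
  have h1 : siteInner f (delta0 C Ω A msq f) = siteInner f (covLaplacianN C Ω A f) + msq * siteInner f f := by
    rw [← siteBilin_apply, delta0_apply, map_add, map_smul, siteBilin_apply, siteBilin_apply, smul_eq_mul]
  rw [h1]
  linarith [siteInner_covLaplacianN_nonneg C Ω A f]

/-- The joint form is non-negative (`m² ≥ 0`): squares plus `⟨φ₀,(−Δ_{Ã}+m²)φ₀⟩ ≥ 0`. [cite: Balaban1982Higgs2, (3.23) p.588] -/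
theorem jointForm_self_nonneg (ha : 0 < a) (hL : 1 < P.L) (hmsq : 0 ≤ msq) (z : Cfg R N × InCfg R N) :
    0 ≤ jointForm R C a A msq z z := by
  rw [jointForm_apply]
  refine add_nonneg (Finset.sum_nonneg fun s _ => mul_nonneg (precAt_pos ha hL (Nat.le_add_left 1 _)).le
    real_inner_self_nonneg) ?_
  exact le_trans (mul_nonneg hmsq (siteInner_self_nonneg _)) (siteInner_delta0_ge C A msq Finset.univ _)

/-- **The fibre block is positive definite** (`m² > 0`): for `Φ = 0` and `φ₀↾_{Λ₅⁽⁰⁾} = u ≠ 0`,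
`jointForm((0,u),(0,u)) ≥ m²ε^d Σ_{x∈Λ₅⁽⁰⁾}|u(x)|² > 0`. [cite: Balaban1982Higgs2, (3.25) p.589] -/
theorem jointForm_fibre_pos (ha : 0 < a) (hL : 1 < P.L) (hmsq : 0 < msq) (u : InCfg R N) (hu : u ≠ 0) :
    0 < jointForm R C a A msq ((0 : Cfg R N), u) ((0 : Cfg R N), u) := by
  rw [jointForm_apply]
  have h1 : 0 ≤ ∑ s : R.BlockSite, precAt P a (R.lvl s)
      * ⟪((0 : Cfg R N), u).1.2 s - qMean C A R (field R ((0 : Cfg R N), u).1.1 ((0 : Cfg R N), u).2) s,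
         ((0 : Cfg R N), u).1.2 s - qMean C A R (field R ((0 : Cfg R N), u).1.1 ((0 : Cfg R N), u).2) s⟫_ℝ :=
    Finset.sum_nonneg fun s _ => mul_nonneg (precAt_pos ha hL (Nat.le_add_left 1 _)).le real_inner_self_nonneg
  refine add_pos_of_nonneg_of_pos h1 (lt_of_lt_of_le ?_ (siteInner_delta0_ge C A msq Finset.univ _))
  refine mul_pos hmsq ?_
  -- ⟨φ₀, φ₀⟩ ≥ ε^d |u(i)|² > 0 for a site i with u(i) ≠ 0
  obtain ⟨i, hi⟩ := Function.ne_iff.mp hu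
  set φ := field R ((0 : Cfg R N), u).1.1 ((0 : Cfg R N), u).2 with hφ
  have hφi : φ i.val = u i := by
    rw [hφ]
    exact field_apply_in R _ u i
  rw [siteInner_self_eq]
  have hterm : 0 < P.mesh 0 ^ P.d * ‖φ i.val‖ ^ 2 := by
    rw [hφi]
    exact mul_pos (pow_pos (P.mesh_pos 0) _) (by positivity)
  exact lt_of_lt_of_le hterm (Finset.single_le_sum (f := fun x => P.mesh 0 ^ P.d * ‖φ x‖ ^ 2)
    (fun x _ => mul_nonneg (pow_nonneg (P.mesh_pos 0).le _) (sq_nonneg _)) (Finset.mem_univ i.val))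

/-- The Gaussian `exp(−½⟨φ₀,(−Δ^ε_{Ã}+m²)φ₀⟩)` has a positive integral over `dφ₀` (p28). [cite: Balaban1982Higgs2, (3.37) p.591] -/
theorem integral_gField_pos {msq : ℝ} (hmsq : 0 < msq) : 0 < ∫ φ₀ : ScalarField P 0 N, gField C A msq φ₀ := by
  have h := integral_exp_neg_half_covMass_pos (P := P) (k := 0) C Finset.univ A hmsq
  unfold gField
  simp_rw [delta0_apply]
  exact h

/-- **`⟨Φ, Δ(Ã^ε)Φ⟩`** of (3.25), on the concrete carrier: the minimum over the fibre `φ₀↾_{Λ₅⁽⁰⁾}` of the joint exponent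
form (= its Schur complement, `form325_eq_fibreForm`). [cite: Balaban1982Higgs2, (3.25) p.589] -/
def form325 (Φ : Cfg R N) : ℝ := ⨅ u : InCfg R N, jointForm R C a A msq (Φ, u) (Φ, u)

/-- **`Z(Ã^ε)`** of (3.25) with *"all the constants coming from the renormalization transformations included"* (p. 590):
the value of the integral (3.23)-with-constants at `Φ = 0`. [cite: Balaban1982Higgs2, (3.25) p.589] -/
def Z325 : ℝ := F325 R C a A msq 0

variable {a msq}

/-- `⟨Φ, Δ(Ã^ε)Φ⟩` is the value of the joint form at the fibre minimiser (Schur complement).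
[cite: Balaban1982Higgs2, (3.25) p.589] -/
theorem form325_eq_fibreForm (ha : 0 < a) (hL : 1 < P.L) (hmsq : 0 < msq) (Φ : Cfg R N) :
    form325 R C a A msq Φ
      = Fibre.fibreForm (jointForm R C a A msq) (jointForm_fibre_pos R C a A msq ha hL hmsq) Φ :=
  Fibre.iInf_eq_fibreForm _ (jointForm_symm R C a A msq) _ Φ

/-- **`Δ(Ã^ε)` of (3.25) as a symmetric bilinear operator on the configurations `Φ`** (the Schur complement of the
`φ₀↾_{Λ₅⁽⁰⁾}`-block of the joint form; `m² > 0` makes that block invertible). [cite: Balaban1982Higgs2, (3.25) p.589] -/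
def delta325 (ha : 0 < a) (hL : 1 < P.L) (hmsq : 0 < msq) : LinearMap.BilinForm ℝ (Cfg R N) :=
  Fibre.schur (jointForm R C a A msq) (jointForm_fibre_pos R C a A msq ha hL hmsq)

/-- `form325 Φ = ⟨Φ, Δ(Ã^ε)Φ⟩` with the bilinear `delta325`. [cite: Balaban1982Higgs2, (3.25) p.589] -/
theorem form325_eq_delta325 (ha : 0 < a) (hL : 1 < P.L) (hmsq : 0 < msq) (Φ : Cfg R N) :
    form325 R C a A msq Φ = delta325 R C A ha hL hmsq Φ Φ := by
  rw [form325_eq_fibreForm R C A ha hL hmsq, Fibre.fibreForm_eq_schur]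
  rfl

/-- `⟨Φ, Δ(Ã^ε)Φ⟩ ≤` the joint exponent form at any `φ₀↾_{Λ₅⁽⁰⁾}`. [cite: Balaban1982Higgs2, (3.25) p.589] -/
theorem form325_le (ha : 0 < a) (hL : 1 < P.L) (hmsq : 0 < msq) (Φ : Cfg R N) (u : InCfg R N) :
    form325 R C a A msq Φ ≤ jointForm R C a A msq (Φ, u) (Φ, u) := by
  rw [form325_eq_fibreForm R C A ha hL hmsq]
  exact Fibre.fibreForm_le _ (jointForm_symm R C a A msq) _ Φ u

/-- `⟨Φ, Δ(Ã^ε)Φ⟩ ≥ 0`. [cite: Balaban1982Higgs2, (3.25) p.589] -/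
theorem form325_nonneg (ha : 0 < a) (hL : 1 < P.L) (hmsq : 0 < msq) (Φ : Cfg R N) : 0 ≤ form325 R C a A msq Φ := by
  rw [form325_eq_fibreForm R C A ha hL hmsq]
  exact Fibre.fibreForm_nonneg _ _ (jointForm_self_nonneg R C a A msq ha hL hmsq.le) Φ

/-- `⟨tΦ, Δ(Ã^ε)(tΦ)⟩ = t²⟨Φ, Δ(Ã^ε)Φ⟩` (a quadratic form — the hypothesis of the substitution (3.36)).
[cite: Balaban1982Higgs2, (3.36) p.591] -/
theorem form325_smul (ha : 0 < a) (hL : 1 < P.L) (hmsq : 0 < msq) (t : ℝ) (Φ : Cfg R N) :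
    form325 R C a A msq (t • Φ) = t ^ 2 * form325 R C a A msq Φ := by
  rw [form325_eq_fibreForm R C A ha hL hmsq, form325_eq_fibreForm R C A ha hL hmsq, Fibre.fibreForm_smul]

/-- `⟨0, Δ(Ã^ε)0⟩ = 0`. [cite: Balaban1982Higgs2, (3.25) p.589] -/
theorem form325_zero (ha : 0 < a) (hL : 1 < P.L) (hmsq : 0 < msq) : form325 R C a A msq 0 = 0 := by
  have h := form325_smul R C A ha hL hmsq 0 (0 : Cfg R N)
  simpa using h

/-- **(3.25) ON THE CONCRETE CARRIER** p. 589: *"(3.23) = Z(Ã^ε)exp(−½⟨Φ, Δ(Ã^ε)Φ⟩)"* — with the constants included,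
`F325(Φ) = Z325 · exp(−½·form325 Φ)`, `Z325 = F325(0)` independent of `Φ`, `form325` a non-negative quadratic form in `Φ`
(completing the square on the fibre `φ₀↾_{Λ₅⁽⁰⁾}` and translating it — `Fibre.integral_eq`). PROVED.
[cite: Balaban1982Higgs2, (3.25) p.589] -/
theorem eq325_concrete (ha : 0 < a) (hL : 1 < P.L) (hmsq : 0 < msq) (Φ : Cfg R N) :
    F325 R C a A msq Φ = Z325 R C a A msq * Real.exp (-(1/2 : ℝ) * form325 R C a A msq Φ) := by
  have key : ∀ Ψ : Cfg R N, F325 R C a A msq Ψ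
      = rtConst R N a * (Real.exp (-(1/2 : ℝ) * form325 R C a A msq Ψ)
          * ∫ u : InCfg R N, Real.exp (-(1/2 : ℝ) * jointForm R C a A msq ((0 : Cfg R N), u) ((0 : Cfg R N), u))) := by
    intro Ψ
    rw [F325_eq, integral323]
    simp_rw [exponent323_eq_jointForm]
    rw [Fibre.integral_eq volume (jointForm R C a A msq) (jointForm_symm R C a A msq)
      (jointForm_fibre_pos R C a A msq ha hL hmsq) Ψ, form325_eq_fibreForm R C A ha hL hmsq]
  rw [Z325, key Φ, key 0, form325_zero R C A ha hL hmsq, mul_zero, Real.exp_zero, one_mul]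
  ring

/-- **`Z(Ã^ε) > 0`.** (If `Z325 ≤ 0` then `F325 ≤ 0` everywhere by (3.25), contradicting (3.36) = (3.37) > 0.)
[cite: Balaban1982Higgs2, (3.25) p.589] -/
theorem Z325_pos (ha : 0 < a) (hL : 1 < P.L) (hmsq : 0 < msq) : 0 < Z325 R C a A msq := by
  by_contra hle
  push Not at hle
  have hF : ∀ Φ : Cfg R N, F325 R C a A msq Φ ≤ 0 := fun Φ => by
    rw [eq325_concrete R C A ha hL hmsq Φ]
    exact mul_nonpos_iff.mpr (Or.inr ⟨hle, (Real.exp_pos _).le⟩)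
  have h1 : ∫ Φ : Cfg R N, F325 R C a A msq Φ ≤ 0 := integral_nonpos hF
  have h2 : 0 < ∫ Φ : Cfg R N, F325 R C a A msq Φ := by
    rw [eq337 R C A ha hL hmsq]
    exact integral_gField_pos C A hmsq
  linarith

end Eq325

end Literature.MathematicalPhysics.QuantumFieldTheory.Balaban1983to89.B2Eq325ConcreteSchur
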